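import Summits.QuantumFields.YangMills.Theorems.BalabanUVNodesPortS1G3CCombesThomas

/-!
# NODE O port PT-A — `stub_G3C` helper (leaves (β)(γ), any edition): THE ACCRETIVE RESOLVENT KIT — for a `Re`-coercive complex kernel `A` (`γ‖z‖² ≤ Re z^*Az`) and every `x ≥ 0`:
# `x·1 + A` is a unit, `‖(x·1 + A)⁻¹ i j‖ ≤ 1/γ`, `‖Σ_{i∈s}(x·1 + A)⁻¹ i i‖ ≤ #s/γ`, `x ↦ (x·1 + A)⁻¹` is continuous on `[0, ∞)`, and — under the `e^{δ₁d}`-weighted Schur bound of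
# ✓`…G3CCombesThomas` — the Combes–Thomas decay `‖(x·1 + A)⁻¹ i j‖ ≤ e^{−κd(i,j)}/(γ/2)` holds UNIFORMLY IN `x ≥ 0` ([16] p.272 «G̃₃(x) has the same properties as G̃₂»)

Cell `ym-nodeO-ideate`, porter hand `hand-27930-G3C` (g0); proof kind, `--supports stmt-QuantumFields-27930 --as helper` (count-neutral).  [16] = [Balaban1985UV3], [B9] = [Balaban1985BackgroundPropagators].

WHY.  `G3CPiecesAt` (✓`…PortS1G3CDefs`) asks the resolvent pieces x-UNIFORMLY on `[0, ∞)` ((g3)) and continuous in `x` ((g5)); every walk edition of `Tr (x + T)⁻¹` (current letter or the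
repaired `G3CAtRecordL`) builds its terms from inverses `(x·1 + T^{(Z)}(φ))⁻¹` of X-localized operators that are `Re`-coercive by (P5ᶜ).  The `x`-vertex `x·1` has non-negative real form, so it
is DROPPED from the coercivity side and costs NOTHING in the conjugation budget (its kernel is diagonal): coercivity, invertibility, the `1/γ` bounds and the Combes–Thomas decay of
✓`G3CCT.norm_inv_apply_le_of_weightedSchur` all hold with the SAME constants for every `x ≥ 0` — the tree's monotone-majorant mechanism (✓`Beta.AccretiveCombesThomas.reCoercive_add_of_re_nonneg`,
cell erratum E9-6) read for the resolvent member of [16] (63).  Continuity in `x` is `adjugate/det` (the complex twin of ✓`B10Eq63Rep.continuousOn_resolvent`).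

WHAT THIS FILE PROVES (sorry-free, generic over a finite index type): `conjForm_one`, `re_conjForm_realSmul_one_add`, `reCoercive_realSmul_one_add`, `conjCoercive_realSmul_one_add`,
`isUnit_det_of_reCoercive`, `isUnit_det_realSmul_one_add`, `norm_inv_apply_le_of_reCoercive` (`≤ 1/γ`), `norm_resolvent_apply_le_of_reCoercive` (x-uniform `1/γ`),
★ `norm_resolvent_apply_le_of_weightedSchur` (x-uniform Combes–Thomas), `norm_sum_resolvent_diag_le` (`‖Σ_{i∈s} (x·1+A)⁻¹ i i‖ ≤ #s/γ`), `continuousOn_resolvent_of_reCoercive` and its entry ∕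
partial-trace forms.

HONEST FRAMING.  Elementary finite-dimensional analysis; nothing of Bałaban's asserted, ported or discharged; `stub_G3C` NOT closed (mis-cut verdict `G3C-OBSTRUCTION-v1.md` stands); 27930 OPEN;
NODE O 0∕1; COUNT 8∕28 · K 1∕4 UNMOVED; finite `𝕋⁴` at fixed ε — NOT continuum ∕ OS ∕ Clay; **the Yang–Mills mass gap is NOT proved by any of this.**  No `sorry`, no `instance`, no `notation`,
no `def`; standard axioms.
-/

noncomputable section

open scoped BigOperators Matrix ComplexConjugate
open Finset Complex Matrix Set

namespace Summit.QuantumFields.YangMills.Theorems.BalabanUVNodesPortS1.G3CCT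

open Summit.QuantumFields.BalabanUV.Beta.AccretiveCombesThomas
open Literature.MathematicalPhysics.QuantumFieldTheory.Balaban1983to89.B5Prop11Lower (nsq nsq_nonneg)

variable {ι : Type*} [Fintype ι] [DecidableEq ι]

/-! ## §1  The `x`-vertex costs nothing: forms of `x·1 + A` -/

/-- The conjugated form of the identity is `‖z‖²` (its kernel is diagonal, so the weight cancels). [folklore] -/
theorem conjForm_one (κ : ℝ) (ρ : ι → ℝ) (z : ι → ℂ) : conjForm (1 : Matrix ι ι ℂ) κ ρ z = ((nsq z : ℝ) : ℂ) := by
  unfold conjForm nsq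
  rw [Complex.ofReal_sum]
  refine Finset.sum_congr rfl fun e _ => ?_
  rw [Finset.sum_eq_single e (fun e' _ hne => by rw [Matrix.one_apply_ne' hne]; ring) (fun h => absurd (Finset.mem_univ e) h),
    Matrix.one_apply_eq, sub_self, mul_zero, Real.exp_zero, Complex.ofReal_one, mul_one, mul_one, Complex.ofReal_pow]
  exact Complex.conj_mul' (z e)

/-- `Re conjForm (x·1 + A) = x·‖z‖² + Re conjForm A` for real `x`. [folklore] -/
theorem re_conjForm_realSmul_one_add (A : Matrix ι ι ℂ) (x κ : ℝ) (ρ : ι → ℝ) (z : ι → ℂ) :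
    (conjForm ((x : ℂ) • (1 : Matrix ι ι ℂ) + A) κ ρ z).re = x * nsq z + (conjForm A κ ρ z).re := by
  rw [conjForm_add, conjForm_smul, conjForm_one, Complex.add_re, ← Complex.ofReal_mul, Complex.ofReal_re]

/-- The plain form: `Re z^*(x·1 + A)z = x·‖z‖² + Re z^*Az` for real `x`. [folklore] -/
theorem re_form_realSmul_one_add (A : Matrix ι ι ℂ) (x : ℝ) (z : ι → ℂ) :
    (star z ⬝ᵥ (((x : ℂ) • (1 : Matrix ι ι ℂ) + A) *ᵥ z)).re = x * nsq z + (star z ⬝ᵥ (A *ᵥ z)).re := by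
  have h := re_conjForm_realSmul_one_add A x 0 (fun _ => 0) z
  rwa [conjForm_zero_rate, conjForm_zero_rate] at h

/-- **`Re`-coercivity is `x`-uniform**: `γ‖z‖² ≤ Re z^*Az` ⟹ `γ‖z‖² ≤ Re z^*(x·1 + A)z` for every `x ≥ 0`. [folklore] -/
theorem reCoercive_realSmul_one_add {A : Matrix ι ι ℂ} {γ : ℝ} (h : ∀ z : ι → ℂ, γ * nsq z ≤ (star z ⬝ᵥ (A *ᵥ z)).re)
    {x : ℝ} (hx : 0 ≤ x) (z : ι → ℂ) : γ * nsq z ≤ (star z ⬝ᵥ ((((x : ℂ) • (1 : Matrix ι ι ℂ) + A)) *ᵥ z)).re := by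
  rw [re_form_realSmul_one_add]
  nlinarith [h z, nsq_nonneg z]

/-- **Conjugated coercivity is `x`-uniform**: the `x`-vertex is diagonal, so it adds `x‖z‖² ≥ 0` to the conjugated form at ANY rate. [folklore] -/
theorem conjCoercive_realSmul_one_add {A : Matrix ι ι ℂ} {κ m : ℝ} {ρ : ι → ℝ} (h : ∀ z : ι → ℂ, m * nsq z ≤ (conjForm A κ ρ z).re)
    {x : ℝ} (hx : 0 ≤ x) (z : ι → ℂ) : m * nsq z ≤ (conjForm ((x : ℂ) • (1 : Matrix ι ι ℂ) + A) κ ρ z).re := by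
  rw [re_conjForm_realSmul_one_add]
  nlinarith [h z, nsq_nonneg z]

/-! ## §2  Invertibility and the `1/γ` bounds, uniformly in `x ≥ 0` -/

/-- A `Re`-coercive kernel has unit determinant. [folklore] -/
theorem isUnit_det_of_reCoercive {A : Matrix ι ι ℂ} {γ : ℝ} (hγ : 0 < γ) (h : ∀ z : ι → ℂ, γ * nsq z ≤ (star z ⬝ᵥ (A *ᵥ z)).re) :
    IsUnit A.det :=
  (Matrix.isUnit_iff_isUnit_det A).1 (isUnit_of_reCoercive hγ h)

/-- `x·1 + A` has unit determinant for every `x ≥ 0`. [folklore] -/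
theorem isUnit_det_realSmul_one_add {A : Matrix ι ι ℂ} {γ : ℝ} (hγ : 0 < γ) (h : ∀ z : ι → ℂ, γ * nsq z ≤ (star z ⬝ᵥ (A *ᵥ z)).re)
    {x : ℝ} (hx : 0 ≤ x) : IsUnit (((x : ℂ) • (1 : Matrix ι ι ℂ) + A)).det :=
  isUnit_det_of_reCoercive hγ (reCoercive_realSmul_one_add h hx)

/-- **`‖A⁻¹ i j‖ ≤ 1/γ`** for a `Re`-coercive kernel (Combes–Thomas at rate `0`). [folklore] -/
theorem norm_inv_apply_le_of_reCoercive {A : Matrix ι ι ℂ} {γ : ℝ} (hγ : 0 < γ) (h : ∀ z : ι → ℂ, γ * nsq z ≤ (star z ⬝ᵥ (A *ᵥ z)).re)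
    (i j : ι) : ‖A⁻¹ i j‖ ≤ 1 / γ := by
  have := norm_inv_apply_le A (fun _ _ => (0 : ℝ)) (fun _ => rfl) le_rfl hγ (fun j z => by rw [conjForm_zero_rate]; exact h z) i j
  simpa using this

/-- **`‖(x·1 + A)⁻¹ i j‖ ≤ 1/γ` uniformly in `x ≥ 0`.** [folklore] -/
theorem norm_resolvent_apply_le_of_reCoercive {A : Matrix ι ι ℂ} {γ : ℝ} (hγ : 0 < γ) (h : ∀ z : ι → ℂ, γ * nsq z ≤ (star z ⬝ᵥ (A *ᵥ z)).re)
    {x : ℝ} (hx : 0 ≤ x) (i j : ι) : ‖(((x : ℂ) • (1 : Matrix ι ι ℂ) + A))⁻¹ i j‖ ≤ 1 / γ :=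
  norm_inv_apply_le_of_reCoercive hγ (reCoercive_realSmul_one_add h hx) i j

/-- **Partial traces of the resolvent**: `‖Σ_{i ∈ s} (x·1 + A)⁻¹ i i‖ ≤ #s/γ` uniformly in `x ≥ 0` (the `Bc`-type constant of (g3): number of indices per cube over `γ₀`). [folklore] -/
theorem norm_sum_resolvent_diag_le {A : Matrix ι ι ℂ} {γ : ℝ} (hγ : 0 < γ) (h : ∀ z : ι → ℂ, γ * nsq z ≤ (star z ⬝ᵥ (A *ᵥ z)).re)
    {x : ℝ} (hx : 0 ≤ x) (s : Finset ι) : ‖∑ i ∈ s, (((x : ℂ) • (1 : Matrix ι ι ℂ) + A))⁻¹ i i‖ ≤ s.card / γ := by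
  calc ‖∑ i ∈ s, (((x : ℂ) • (1 : Matrix ι ι ℂ) + A))⁻¹ i i‖ ≤ ∑ i ∈ s, ‖(((x : ℂ) • (1 : Matrix ι ι ℂ) + A))⁻¹ i i‖ := norm_sum_le _ _
    _ ≤ ∑ _i ∈ s, 1 / γ := Finset.sum_le_sum fun i _ => norm_resolvent_apply_le_of_reCoercive hγ h hx i i
    _ = s.card / γ := by rw [Finset.sum_const, nsmul_eq_mul]; ring

/-- ★ **x-UNIFORM COMBES–THOMAS** («G̃₃(x) has the same properties as G̃₂», [16] p.272): under `Re`-coercivity `γ` and the `e^{δ₁d}`-weighted Schur bound `c` of `A`, every rate `κ` with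
`0 ≤ κ`, `2κ ≤ δ₁`, `4κc ≤ γδ₁` gives `‖(x·1 + A)⁻¹ i j‖ ≤ e^{−κ·d(i,j)}/(γ/2)` for EVERY `x ≥ 0` — the `x`-vertex enters neither the budget nor the constant.
[cite: Balaban1985UV3, p.272 (after (63)); Balaban1985BackgroundPropagators, (3.42) p.399] -/
theorem norm_resolvent_apply_le_of_weightedSchur (A : Matrix ι ι ℂ) (d : ι → ι → ℝ) (hd0 : ∀ j, d j j = 0)
    (hd : ∀ i j, 0 ≤ d i j) (hsymm : ∀ i j, d i j = d j i) (htri : ∀ i j l, d i l ≤ d i j + d j l)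
    {γ c δ₁ κ : ℝ} (hγ : 0 < γ) (hδ₁ : 0 < δ₁) (hκ : 0 ≤ κ) (hκδ : 2 * κ ≤ δ₁) (hκc : 4 * κ * c ≤ γ * δ₁)
    (hcoer : ∀ z : ι → ℂ, γ * nsq z ≤ (star z ⬝ᵥ (A *ᵥ z)).re)
    (hrow : ∀ i, ∑ j, ‖A i j‖ * Real.exp (δ₁ * d i j) ≤ c) (hcol : ∀ j, ∑ i, ‖A i j‖ * Real.exp (δ₁ * d i j) ≤ c)
    {x : ℝ} (hx : 0 ≤ x) (i j : ι) :
    ‖(((x : ℂ) • (1 : Matrix ι ι ℂ) + A))⁻¹ i j‖ ≤ Real.exp (-(κ * d i j)) / (γ / 2) :=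
  norm_inv_apply_le _ d hd0 hκ (half_pos hγ)
    (fun j' z => conjCoercive_realSmul_one_add
      (conjCoercive_of_weightedSchur A d hd hδ₁ hκ hκδ hκc hcoer hrow hcol (abs_sub_col_le d hsymm htri j')) hx z) i j

/-! ## §3  Continuity in `x ≥ 0` -/

/-- **The resolvent of a `Re`-coercive complex kernel is continuous on `[0, ∞)`** (`adjugate/det`, `det ≠ 0` by coercivity) — row (g5) for every term of a walk edition.
[cite: Balaban1985UV3, p.272 (after (63))] -/
theorem continuousOn_resolvent_of_reCoercive {A : Matrix ι ι ℂ} {γ : ℝ} (hγ : 0 < γ) (h : ∀ z : ι → ℂ, γ * nsq z ≤ (star z ⬝ᵥ (A *ᵥ z)).re) :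
    ContinuousOn (fun x : ℝ => (((x : ℂ) • (1 : Matrix ι ι ℂ) + A))⁻¹) (Ici 0) := by
  have hA : Continuous (fun x : ℝ => (x : ℂ) • (1 : Matrix ι ι ℂ) + A) :=
    (Complex.continuous_ofReal.smul continuous_const).add continuous_const
  have hdet : ∀ x ∈ Ici (0 : ℝ), (((x : ℂ) • (1 : Matrix ι ι ℂ) + A)).det ≠ 0 :=
    fun x hx => (isUnit_det_realSmul_one_add hγ h hx).ne_zero
  have hc : ContinuousOn (fun x : ℝ => ((((x : ℂ) • (1 : Matrix ι ι ℂ) + A)).det)⁻¹ •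
      (((x : ℂ) • (1 : Matrix ι ι ℂ) + A)).adjugate) (Ici 0) :=
    (((Continuous.matrix_det hA).continuousOn).inv₀ hdet).smul (Continuous.matrix_adjugate hA).continuousOn
  refine hc.congr fun x _ => ?_
  rw [Matrix.inv_def, Ring.inverse_eq_inv']

/-- The resolvent ENTRIES are continuous on `[0, ∞)`. [folklore] -/
theorem continuousOn_resolvent_apply_of_reCoercive {A : Matrix ι ι ℂ} {γ : ℝ} (hγ : 0 < γ)
    (h : ∀ z : ι → ℂ, γ * nsq z ≤ (star z ⬝ᵥ (A *ᵥ z)).re) (i j : ι) :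
    ContinuousOn (fun x : ℝ => (((x : ℂ) • (1 : Matrix ι ι ℂ) + A))⁻¹ i j) (Ici 0) :=
  (continuous_apply_apply i j).comp_continuousOn (continuousOn_resolvent_of_reCoercive hγ h)

/-- Partial traces of the resolvent are continuous on `[0, ∞)`. [folklore] -/
theorem continuousOn_sum_resolvent_diag_of_reCoercive {A : Matrix ι ι ℂ} {γ : ℝ} (hγ : 0 < γ)
    (h : ∀ z : ι → ℂ, γ * nsq z ≤ (star z ⬝ᵥ (A *ᵥ z)).re) (s : Finset ι) :
    ContinuousOn (fun x : ℝ => ∑ i ∈ s, (((x : ℂ) • (1 : Matrix ι ι ℂ) + A))⁻¹ i i) (Ici 0) :=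
  continuousOn_finsetSum s fun i _ => continuousOn_resolvent_apply_of_reCoercive hγ h i i

end Summit.QuantumFields.YangMills.Theorems.BalabanUVNodesPortS1.G3CCT

end
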